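/-
Copyright (c) 2026 the pub-hodgecm-mathlib formalisation cell (harness21).  Prover seat hodgecm-mathlib-K2Liu-p26 (g2): Track B «K2-LIT»,
#184♮ = hLiu418 = stmt-HodgeConjecture-24832; #42S organ S1, (G) organ ROW (ρ-mid), step (M2a-C4-ns): THE NON-SPLIT READING TRANSPORT — the `(e, hμ)` slots of
★ `K2LiuNonsplitMiddleProfileRow.factorisation_of_leviRow_reading` (F0P2-p07 (g0)) over the `cX` of ★ (C3-e)∕(C3-c″) `K2LiuTensorMiddleCellPoint{Reading,Rows}`.
-/
import Summits.HodgeConjecture.HodgeConjecture.Theorems.K2LiuLocalRingPlaceDecomposition   -- ★ (R2) `exists_homeomorph_single_of_forall_eq`, ★ (R4) `exists_addHaar_eq_smul_map`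
import Literature.NumberTheory.Automorphic.AdicCompletionLocalField                        -- ★ `E_w`, `F_v` are non-archimedean local fields (instances)
import Literature.NumberTheory.Automorphic.TateLocalZetaShells                             -- ★ `secondCountableTopology_localField`
import Mathlib.Topology.Algebra.Module.Equiv
import Mathlib.MeasureTheory.Constructions.Pi
import HarnessLib

/-!
# Crux `HLiu418`, #42S organ S1, (G) organ ROW (ρ-mid), step (M2a-C4-ns): THE NON-SPLIT READING TRANSPORT —
# `e : X₁ ≃ₜ (K × K) × K`, `e x₁ = ((β, γ), α)(x₁) = reorder ((cX x₁ · )(w₀) ᵥ* P₃⁻¹)`, additive, with the Haar letter `μ_K³ = c_e • e_* μ_{X₁}`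

Cell `hodgecm-mathlib`, crux item hLiu418 = `stmt-HodgeConjecture-24832`, route of record `HCCMUnconditional`; squad K2 ∕ K2Liu, road `K2_Liu`, socket #42S (a),
organ S1; LEAD F0P6-plan (g14); (M2a) chain ★ (C3) p862499 → ★ (C3-e) p862649 → ★ (C3-c″) p862725 (`cX : X₁ ≃L[F_v] (Fin 3 → E ⊗ F_v)` and the `κ`-rows
`(α·a, β·a, γ·a)` with `(α, β, γ)(x₁) = ((fun l => cX x₁ l w₀) ᵥ* P₃⁻¹)`) → THIS FILE → ★ `K2LiuNonsplitMiddleProfileRow.factorisation_of_leviRow_reading` (F0P2-p07 (g0);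
its `(e, hμ)` binders) → `hfac±` of ★ `K2LiuLocalSWSpanningInertOfPackages` ∕ the ramified `hfac` of ★ `K2LiuLocalSWSpanningRamifiedOfMpMoverMiddleRow`.
THEOREMS ONLY (no `def`, no `instance`, no `notation`, no named-fact hypothesis, no `sorry`); lane `--supports stmt-HodgeConjecture-24832` (count-neutral helper).

WHAT.  At a NON-SPLIT place (`w₀` the only place of `E` above `v`, `K := E_{w₀}`), given ANY continuous linear equivalence `cX : (Fin m → F_v) ≃L[F_v] (Fin 3 → E ⊗ F_v)`
(★ (C3-e)'s, `m = 3 + 3`) and ANY invertible `P₃ ∈ M₃(K)` (the witness frame of (K1)):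
* §1 `exists_homeomorph_eval_pi` — `(Fin n → E ⊗ F_v) ≃ₜ (Fin n → K)`, `u ↦ (u l)(w₀)` (★ (R2) `exists_homeomorph_single_of_forall_eq`, coordinatewise), additive;
  `exists_homeomorph_vecMul` — `u ↦ u ᵥ* Q` on `Fin n → K` for invertible `Q` (polynomial both ways), additive; `exists_homeomorph_reorder3` — `(Fin 3 → K) ≃ₜ (K × K) × K`,
  `u ↦ ((u 1, u 2), u 0)` (the variable order `((β, γ), α)` of ★ (M2b) ∕ ★ `factorisation_of_leviRow_reading`), additive.
* §2 **`exists_nonsplitReadingTransport`** — the composite `e := reorder ∘ (· ᵥ* P₃⁻¹) ∘ eval_{w₀} ∘ cX : (Fin m → F_v) ≃ₜ (K × K) × K` with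
  `e x₁ = ((c′ 1, c′ 2), c′ 0)`, `c′ := (fun l => cX x₁ l w₀) ᵥ* P₃⁻¹`, is an ADDITIVE HOMEOMORPHISM, hence (★ (R4) `exists_addHaar_eq_smul_map`) for any Haar measures
  `μ_v` on `F_v` and `μ_K` on `K`: `∃ c_e > 0, (μ_K.prod μ_K).prod μ_K = c_e • Measure.map e (Measure.pi fun _ => μ_v)` (as a measurable equivalence `e`, continuous both ways) — LITERALLY the `(e, hce, hμ)`
  binders of ★ `factorisation_of_leviRow_reading` with `(e y).2 = α`, `(e y).1.1 = β`, `(e y).1.2 = γ`.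
References: [WeilBNT1967] Ch. II §5 Prop. 12 (uniqueness of Haar measure); [CasselsFrohlichANT1967] Ch. II §10–§11 (`E ⊗ F_v = Π_{w∣v} E_w`); [Kudla1994] §3 Thm. 3.1;
[KudlaSweet1997] §1.
HONEST LABEL.  Count-neutral helper; it retires nothing by itself: `HC_CM` is proved only modulo the 7 printed citations (2 remaining named inputs:
hLiu418 = `stmt-HodgeConjecture-24832`, h413 = `stmt-HodgeConjecture-24833`) until rung 0 closes.

## References
* [WeilBNT1967] A. Weil, *Basic Number Theory* (1967), Ch. II §5 Prop. 12.
* [CasselsFrohlichANT1967] J. W. S. Cassels, A. Fröhlich (eds.), *Algebraic Number Theory* (1967), Ch. II §10–§11.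
* [Kudla1994] S. S. Kudla, Israel J. Math. 87 (1994), §3 Thm. 3.1.
* [KudlaSweet1997] S. S. Kudla, W. J. Sweet, Israel J. Math. 98 (1997), §1.
-/

set_option autoImplicit false
set_option linter.dupNamespace false -- the mandated namespace repeats `HodgeConjecture.HodgeConjecture`

noncomputable section

open NumberField IsDedekindDomain MeasureTheory Matrix
open scoped NNReal ENNReal
open Literature.NumberTheory.Automorphic Literature.NumberTheory.Automorphic.UnitaryGroup
open Literature.NumberTheory.GaloisRepresentations Literature.NumberTheory.GaloisRepresentations.IsNonarchimedeanLocalField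
open Literature.NumberTheory.Automorphic.LocalFieldHaar
open Summit.HodgeConjecture.HodgeConjecture.Cruxes.HLiu418.K2LiuLocalRingPlaceDecomposition

namespace Summit.HodgeConjecture.HodgeConjecture.Cruxes.HLiu418.K2LiuNonsplitReadingTransport

variable (F : Type) [Field F] [NumberField F] (E : Type) [Field E] [NumberField E] [Algebra F E] (v : HeightOneSpectrum (𝓞 F))
  (w₀ : PlacesOver E v)

/-! ## §1 The three additive homeomorphisms: evaluation at `w₀`, the frame change `· ᵥ* Q`, the reorder `((u 1, u 2), u 0)` -/

omit [NumberField F] in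
/-- **EVALUATION AT THE ONLY PLACE `w₀`** is an additive homeomorphism `(Fin n → E ⊗ F_v) ≃ₜ (Fin n → E_{w₀})` at a non-split place (★ (R2), coordinatewise).
[cite: CasselsFrohlichANT1967, Ch. II §10–§11] -/
theorem exists_homeomorph_eval_pi (hw₀ : ∀ w : PlacesOver E v, w = w₀) (n : ℕ) :
    ∃ θ : (Fin n → LocalRing E v) ≃ₜ (Fin n → w₀.1.adicCompletion E),
      (∀ (u : Fin n → LocalRing E v) (l : Fin n), θ u l = u l w₀) ∧ ∀ u u' : Fin n → LocalRing E v, θ (u + u') = θ u + θ u' := by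
  classical
  obtain ⟨e₁, he₁, -⟩ := exists_homeomorph_single_of_forall_eq F E v w₀ hw₀
  -- `e₁⁻¹` is evaluation at `w₀`
  have hsymm : ∀ x : LocalRing E v, e₁.symm x = x w₀ := fun x => by
    rw [Homeomorph.symm_apply_eq, he₁]
    funext w
    rcases hw₀ w with rfl
    rw [Pi.single_eq_same]
  refine ⟨Homeomorph.piCongrRight fun _ => e₁.symm, fun u l => ?_, fun u u' => ?_⟩
  · show e₁.symm (u l) = u l w₀
    exact hsymm (u l)
  · funext l
    show e₁.symm ((u + u') l) = e₁.symm (u l) + e₁.symm (u' l)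
    rw [hsymm, hsymm, hsymm, Pi.add_apply, Pi.add_apply]

/-- **THE FRAME CHANGE `u ↦ u ᵥ* Q`** on `Fin n → K` (`K` a topological ring, `Q` invertible) is an additive homeomorphism (inverse `u ↦ u ᵥ* Q⁻¹`; both polynomial).
[folklore] -/
theorem exists_homeomorph_vecMul {K : Type*} [Field K] [TopologicalSpace K] [IsTopologicalRing K] {n : ℕ} (Q : Matrix (Fin n) (Fin n) K) (hQ : IsUnit Q.det) :
    ∃ φ : (Fin n → K) ≃ₜ (Fin n → K), (∀ u, φ u = u ᵥ* Q) ∧ ∀ u u', φ (u + u') = φ u + φ u' := by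
  have hcQ : ∀ M : Matrix (Fin n) (Fin n) K, Continuous fun u : Fin n → K => u ᵥ* M := fun M =>
    continuous_pi fun j => by
      simp only [Matrix.vecMul, dotProduct]
      exact continuous_finsetSum _ fun i _ => (continuous_apply i).mul continuous_const
  let e : (Fin n → K) ≃ (Fin n → K) :=
    { toFun := fun u => u ᵥ* Q, invFun := fun u => u ᵥ* Q⁻¹
      left_inv := fun u => by simp only [Matrix.vecMul_vecMul, Matrix.mul_nonsing_inv _ hQ, Matrix.vecMul_one]
      right_inv := fun u => by simp only [Matrix.vecMul_vecMul, Matrix.nonsing_inv_mul _ hQ, Matrix.vecMul_one] }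
  exact ⟨⟨e, hcQ Q, hcQ Q⁻¹⟩, fun u => rfl, fun u u' => Matrix.add_vecMul Q u u'⟩

/-- **THE REORDER `u ↦ ((u 1, u 2), u 0)`**: `(Fin 3 → K) ≃ₜ (K × K) × K` — the variable order `((β, γ), α)` of ★ (M2b) — an additive homeomorphism.
[folklore] -/
theorem exists_homeomorph_reorder3 {K : Type*} [AddCommGroup K] [TopologicalSpace K] :
    ∃ r : (Fin 3 → K) ≃ₜ (K × K) × K, (∀ u, r u = ((u 1, u 2), u 0)) ∧ ∀ u u', r (u + u') = r u + r u' := by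
  let eq : (Fin 3 → K) ≃ (K × K) × K :=
    { toFun := fun u => ((u 1, u 2), u 0)
      invFun := fun p => ![p.2, p.1.1, p.1.2]
      left_inv := fun u => by
        funext i
        fin_cases i <;> rfl
      right_inv := fun p => rfl }
  have hc : Continuous fun u : Fin 3 → K => ((u 1, u 2), u 0) :=
    ((continuous_apply 1).prodMk (continuous_apply 2)).prodMk (continuous_apply 0)
  have hc' : Continuous fun p : (K × K) × K => (![p.2, p.1.1, p.1.2] : Fin 3 → K) := by
    refine continuous_pi fun i => ?_
    fin_cases i
    · exact continuous_snd
    · exact continuous_fst.fst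
    · exact continuous_fst.snd
  exact ⟨⟨eq, hc, hc'⟩, fun u => rfl, fun u u' => rfl⟩

/-! ## §2 The non-split reading transport and its Haar letter -/

/-- **(M2a-C4-ns) THE NON-SPLIT READING TRANSPORT.**  At a non-split place (`hw₀ : ∀ w, w = w₀`, `K = E_{w₀}`), for any continuous linear equivalence
`cX : (Fin m → F_v) ≃L[F_v] (Fin 3 → E ⊗ F_v)` (★ (C3-e)'s) and any invertible `P₃ ∈ M₃(K)` (the witness frame of (K1)), there is an additive homeomorphism
`e : (Fin m → F_v) ≃ₜ (K × K) × K` with `e x₁ = ((c′ 1, c′ 2), c′ 0)`, `c′ = (fun l => cX x₁ l w₀) ᵥ* P₃⁻¹` (so `(e x₁).2 = α`, `(e x₁).1.1 = β`, `(e x₁).1.2 = γ` of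
★ (C3-c″) `exists_pointRows`), and for all Haar measures `μ_v`, `μ_K` ONE constant `c_e > 0` with `(μ_K.prod μ_K).prod μ_K = c_e • e_* (Measure.pi fun _ => μ_v)`
(★ (R4)) — the `(e, hce, hμ)` binders of ★ `K2LiuNonsplitMiddleProfileRow.factorisation_of_leviRow_reading` BY NAME.
[cite: WeilBNT1967, Ch. II §5 Prop. 12] [cite: CasselsFrohlichANT1967, Ch. II §10–§11] [cite: Kudla1994, §3 Thm. 3.1] -/
theorem exists_nonsplitReadingTransport (hw₀ : ∀ w : PlacesOver E v, w = w₀) {m : ℕ}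
    (cX : (Fin m → v.adicCompletion F) ≃L[v.adicCompletion F] (Fin 3 → LocalRing E v))
    (P₃ : Matrix (Fin 3) (Fin 3) (w₀.1.adicCompletion E)) (hP₃ : IsUnit P₃.det)
    [MeasurableSpace (v.adicCompletion F)] [BorelSpace (v.adicCompletion F)] (μv : Measure (v.adicCompletion F)) [μv.IsAddHaarMeasure]
    [MeasurableSpace (w₀.1.adicCompletion E)] [BorelSpace (w₀.1.adicCompletion E)] (μK : Measure (w₀.1.adicCompletion E)) [μK.IsAddHaarMeasure] :
    ∃ (e : (Fin m → v.adicCompletion F) ≃ᵐ (w₀.1.adicCompletion E × w₀.1.adicCompletion E) × w₀.1.adicCompletion E) (ce : ℝ≥0), 0 < ce ∧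
      (μK.prod μK).prod μK = (ce : ℝ≥0∞) • Measure.map e (Measure.pi fun _ => μv) ∧
      (∀ x₁ : Fin m → v.adicCompletion F,
        e x₁ = ((((fun l => cX x₁ l w₀) ᵥ* P₃⁻¹) 1, ((fun l => cX x₁ l w₀) ᵥ* P₃⁻¹) 2), ((fun l => cX x₁ l w₀) ᵥ* P₃⁻¹) 0)) ∧
      Continuous e ∧ Continuous e.symm ∧ ∀ p p' : Fin m → v.adicCompletion F, e (p + p') = e p + e p' := by
  haveI : SecondCountableTopology (v.adicCompletion F) := secondCountableTopology_localField (v.adicCompletion F)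
  haveI : SecondCountableTopology (w₀.1.adicCompletion E) := secondCountableTopology_localField (w₀.1.adicCompletion E)
  haveI : SigmaCompactSpace (v.adicCompletion F) := sigmaCompactSpace_of_isNonarchimedeanLocalField (v.adicCompletion F)
  haveI : SigmaCompactSpace (w₀.1.adicCompletion E) := sigmaCompactSpace_of_isNonarchimedeanLocalField (w₀.1.adicCompletion E)
  haveI : SigmaFinite μK := inferInstance
  haveI : MeasurableAdd (w₀.1.adicCompletion E) := inferInstance
  haveI : (μK.prod μK).IsAddHaarMeasure := Measure.prod.instIsAddHaarMeasure μK μK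
  haveI : ((μK.prod μK).prod μK).IsAddHaarMeasure := Measure.prod.instIsAddHaarMeasure _ _
  haveI : (Measure.pi fun _ : Fin m => μv).IsAddHaarMeasure := Measure.pi.isAddHaarMeasure _
  have hP₃i : IsUnit (P₃⁻¹).det := by
    rw [Matrix.isUnit_nonsing_inv_det_iff]
    exact hP₃
  obtain ⟨θ, hθ, hθadd⟩ := exists_homeomorph_eval_pi F E v w₀ hw₀ 3
  obtain ⟨φ, hφ, hφadd⟩ := exists_homeomorph_vecMul (K := w₀.1.adicCompletion E) P₃⁻¹ hP₃i
  obtain ⟨r, hr, hradd⟩ := exists_homeomorph_reorder3 (K := w₀.1.adicCompletion E)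
  -- the composite
  let e : (Fin m → v.adicCompletion F) ≃ₜ (w₀.1.adicCompletion E × w₀.1.adicCompletion E) × w₀.1.adicCompletion E :=
    ((cX.toHomeomorph.trans θ).trans φ).trans r
  have he : ∀ x₁, e x₁ = ((((fun l => cX x₁ l w₀) ᵥ* P₃⁻¹) 1, ((fun l => cX x₁ l w₀) ᵥ* P₃⁻¹) 2), ((fun l => cX x₁ l w₀) ᵥ* P₃⁻¹) 0) := by
    intro x₁
    have hθ' : θ (cX x₁) = fun l => cX x₁ l w₀ := funext fun l => hθ _ l
    show r (φ (θ (cX.toHomeomorph x₁))) = _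
    rw [ContinuousLinearEquiv.coe_toHomeomorph, hθ', hφ, hr]
  have hadd : ∀ p p' : Fin m → v.adicCompletion F, e (p + p') = e p + e p' := by
    intro p p'
    show r (φ (θ (cX.toHomeomorph (p + p')))) = r (φ (θ (cX.toHomeomorph p))) + r (φ (θ (cX.toHomeomorph p')))
    rw [ContinuousLinearEquiv.coe_toHomeomorph, map_add, hθadd, hφadd, hradd]
  obtain ⟨ce, hce, hμ⟩ := exists_addHaar_eq_smul_map e hadd (Measure.pi fun _ => μv) ((μK.prod μK).prod μK)
  refine ⟨e.toMeasurableEquiv, ce, hce, ?_, fun x₁ => ?_, ?_, ?_, fun p p' => ?_⟩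
  · rw [Homeomorph.toMeasurableEquiv_coe]; exact hμ
  · rw [Homeomorph.toMeasurableEquiv_coe]; exact he x₁
  · rw [Homeomorph.toMeasurableEquiv_coe]; exact e.continuous
  · rw [Homeomorph.toMeasurableEquiv_symm_coe]; exact e.symm.continuous
  · rw [Homeomorph.toMeasurableEquiv_coe]; exact hadd p p'

end Summit.HodgeConjecture.HodgeConjecture.Cruxes.HLiu418.K2LiuNonsplitReadingTransport

end
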